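import Summits.Langlands.Langlands.Theses.NonParallelVoid

/-!
# Sketch — crux-ideate `ResidueParallel` (stmt-Langlands-17003), ideator 1, round 1

First lemmas of two crux ideas, typed over the crux's own vocabulary (every constant is one the
route file `NonParallelVoid.lean` already uses, plus `Algebra.IsUnramifiedIn` as in
`Lines/inert_fl_transfer.lean` and `FramedGaloisRep.IsResiduallyAbsIrreducible ρ` over `F` itself).
Nothing here is proved; the defs must only elaborate.
-/

namespace Summit.Langlands.Langlands.Cruxes.ResidueParallel

/-! ## Idea `cyclotomic-dihedral-pinch` -/
namespace CyclotomicDihedralPinch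

/-- **Pinch lemma (first lemma of the line).** `F` imaginary quadratic, `p ≥ 5` unramified in
`F`, `ρ` as in the crux (irreducible, a.e. unramified, de Rham with two distinct labelled weights),
NOT nearly ordinary, crystalline at every `v ∣ p` with all labelled gaps in the Fontaine–Laffaille
window `b - a ≤ p - 2`, `ρ̄` absolutely irreducible over `F` but NOT over `F(ζ_p)` (the residually
dihedral cell of the residue).  Then either the gaps are already parallel, or EVERY labelled gap
`g = b - a` satisfies `2g = p + 1 ∨ 2g = p - 1` (and by non-parallelness both values occur).
Mechanism: Clifford (`ρ̄ ≅ Ind` from `K = F(√p*)`), Breuil/Fontaine–Laffaille ("irreducible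
FL-crystalline over `ℚ_p` ⇔ irreducible reduction"; mixed-type reductions over `ℚ_(p²)`), and the
Khare–Wintenberger numerology `ind ω₂^g` reducible on `G_(ℚ_p(ζ_p))` iff `(p+1)/2 ∣ g`. -/
def PinchGap : Prop :=
  ∀ (F : Type) [Field F] [NumberField F] [Algebra.IsQuadraticExtension ℚ F], NumberField.IsTotallyComplex F → ∀ (p : ℕ) [Fact p.Prime] (ρ : Literature.NumberTheory.GaloisRepresentations.FramedGaloisRep F (PadicAlgCl p) 2), ρ.toGaloisRep.IsIrreducible → (∀ᶠ v : IsDedekindDomain.HeightOneSpectrum (NumberField.RingOfIntegers F) in Filter.cofinite, ρ.IsUnramifiedAt v) → (∀ (v : IsDedekindDomain.HeightOneSpectrum (NumberField.RingOfIntegers F)) (hv : ((p : ℕ) : NumberField.RingOfIntegers F) ∈ v.asIdeal), (Literature.NumberTheory.PAdicHodge.fontainePstAdicCompletion v p hv).IsDeRhamFramed (ρ.toLocal v) ∧ (letI := (Literature.NumberTheory.PAdicHodge.fontainePstAdicCompletion v p hv).algebra; ∀ τ : v.adicCompletion F →ₐ[ℚ_[p]] PadicAlgCl p, ∃ a b :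 ℤ, a < b ∧ ρ.labelledHodgeTateWeightsAt v (Literature.NumberTheory.PAdicHodge.fontainePstAdicCompletion v p hv).algebra (Literature.NumberTheory.PAdicHodge.fontainePstAdicCompletion v p hv).𝔅 τ.toRingHom = {a, b})) → ¬ (∀ v : IsDedekindDomain.HeightOneSpectrum (NumberField.RingOfIntegers F), ((p : ℕ) : NumberField.RingOfIntegers F) ∈ v.asIdeal → Literature.NumberTheory.GaloisRepresentations.FramedRep.HasInvariantCompleteFlag (ρ.toLocal v)) → 5 ≤ p → Algebra.IsUnramifiedIn (NumberField.RingOfIntegers F) (Ideal.span {(p : ℤ)}) → (∀ (v : IsDedekindDomain.HeightOneSpectrum (NumberField.RingOfIntegers F)) (hv : ((p : ℕ) : NumberField.RingOfIntegers F) ∈ v.asIdeal), (Literature.NumberTheory.PAdicHodge.fontainePstAdicCompletion v p hv).IsCrystallineFramed (ρ.toLocal v)) → (∀ (v : IsDedekindDomain.HeightOneSpectrum (NumberField.RingOfIntegers F)) (hv : ((p : ℕ) : NumberField.RingOfIntegers F) ∈ v.asIdeal), letI := (Literature.NumberTheory.PAdicHodge.fontainePstAdicCompletion v p hv).algebra;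 ∀ (τ : v.adicCompletion F →ₐ[ℚ_[p]] PadicAlgCl p) (a b : ℤ), ρ.labelledHodgeTateWeightsAt v (Literature.NumberTheory.PAdicHodge.fontainePstAdicCompletion v p hv).algebra (Literature.NumberTheory.PAdicHodge.fontainePstAdicCompletion v p hv).𝔅 τ.toRingHom = {a, b} → a < b → b - a + 2 ≤ (p : ℤ)) → ¬ Literature.NumberTheory.GaloisRepresentations.FramedGaloisRep.IsResiduallyAbsIrreducible (ρ.restrictField (CyclotomicField p F)) → Literature.NumberTheory.GaloisRepresentations.FramedGaloisRep.IsResiduallyAbsIrreducible ρ → (∃ g : ℤ, ∀ (v : IsDedekindDomain.HeightOneSpectrum (NumberField.RingOfIntegers F)) (hv : ((p : ℕ) : NumberField.RingOfIntegers F) ∈ v.asIdeal), letI := (Literature.NumberTheory.PAdicHodge.fontainePstAdicCompletion v p hv).algebra; ∀ τ : v.adicCompletion F →ₐ[ℚ_[p]] PadicAlgCl p, ∃ a : ℤ, ρ.labelledHodgeTateWeightsAt v (Literature.NumberTheory.PAdicHodge.fontainePstAdicCompletion v p hv).algebra (Literature.NumberTheory.PAdicHodge.fontainePstAdicCompletion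 v p hv).𝔅 τ.toRingHom = {a, a + g}) ∨ (∀ (v : IsDedekindDomain.HeightOneSpectrum (NumberField.RingOfIntegers F)) (hv : ((p : ℕ) : NumberField.RingOfIntegers F) ∈ v.asIdeal), letI := (Literature.NumberTheory.PAdicHodge.fontainePstAdicCompletion v p hv).algebra; ∀ (τ : v.adicCompletion F →ₐ[ℚ_[p]] PadicAlgCl p) (a b : ℤ), ρ.labelledHodgeTateWeightsAt v (Literature.NumberTheory.PAdicHodge.fontainePstAdicCompletion v p hv).algebra (Literature.NumberTheory.PAdicHodge.fontainePstAdicCompletion v p hv).𝔅 τ.toRingHom = {a, b} → a < b → 2 * (b - a) = (p : ℤ) + 1 ∨ 2 * (b - a) = (p : ℤ) - 1)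

/-- **Unit-parity kill (second statement of the line).** In the same cell, if moreover `ρ` is
unramified at every finite place away from `p`, the gaps ARE parallel: the pinch forces gap sum
`= p` (odd), while a mod-`p` character of `Γ_F` unramified outside `p` (here `det ρ̄`) has
inertial exponents at the places above `p` whose sum is even (the global unit `-1`;
`𝒪_F^× ⊇ {±1}`). -/
def PinchUnramified : Prop :=
  ∀ (F : Type) [Field F] [NumberField F] [Algebra.IsQuadraticExtension ℚ F], NumberField.IsTotallyComplex F → ∀ (p : ℕ) [Fact p.Prime] (ρ : Literature.NumberTheory.GaloisRepresentations.FramedGaloisRep F (PadicAlgCl p) 2), ρ.toGaloisRep.IsIrreducible → (∀ᶠ v : IsDedekindDomain.HeightOneSpectrum (NumberField.RingOfIntegers F) in Filter.cofinite, ρ.IsUnramifiedAt v) → (∀ (v : IsDedekindDomain.HeightOneSpectrum (NumberField.RingOfIntegers F)) (hv : ((p : ℕ) : NumberField.RingOfIntegers F) ∈ v.asIdeal), (Literature.NumberTheory.PAdicHodge.fontainePstAdicCompletion v p hv).IsDeRhamFramed (ρ.toLocal v) ∧ (letI := (Literature.NumberTheory.PAdicHodge.fontainePstAdicCompletion v p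 hv).algebra; ∀ τ : v.adicCompletion F →ₐ[ℚ_[p]] PadicAlgCl p, ∃ a b : ℤ, a < b ∧ ρ.labelledHodgeTateWeightsAt v (Literature.NumberTheory.PAdicHodge.fontainePstAdicCompletion v p hv).algebra (Literature.NumberTheory.PAdicHodge.fontainePstAdicCompletion v p hv).𝔅 τ.toRingHom = {a, b})) → ¬ (∀ v : IsDedekindDomain.HeightOneSpectrum (NumberField.RingOfIntegers F), ((p : ℕ) : NumberField.RingOfIntegers F) ∈ v.asIdeal → Literature.NumberTheory.GaloisRepresentations.FramedRep.HasInvariantCompleteFlag (ρ.toLocal v)) → 5 ≤ p → Algebra.IsUnramifiedIn (NumberField.RingOfIntegers F) (Ideal.span {(p : ℤ)}) → (∀ (v : IsDedekindDomain.HeightOneSpectrum (NumberField.RingOfIntegers F)) (hv : ((p : ℕ) : NumberField.RingOfIntegers F) ∈ v.asIdeal), (Literature.NumberTheory.PAdicHodge.fontainePstAdicCompletion v p hv).IsCrystallineFramed (ρ.toLocal v)) → (∀ (v : IsDedekindDomain.HeightOneSpectrum (NumberField.RingOfIntegers F)) (hv : ((p : ℕ) : NumberField.RingOfIntegers F) ∈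 v.asIdeal), letI := (Literature.NumberTheory.PAdicHodge.fontainePstAdicCompletion v p hv).algebra; ∀ (τ : v.adicCompletion F →ₐ[ℚ_[p]] PadicAlgCl p) (a b : ℤ), ρ.labelledHodgeTateWeightsAt v (Literature.NumberTheory.PAdicHodge.fontainePstAdicCompletion v p hv).algebra (Literature.NumberTheory.PAdicHodge.fontainePstAdicCompletion v p hv).𝔅 τ.toRingHom = {a, b} → a < b → b - a + 2 ≤ (p : ℤ)) → ¬ Literature.NumberTheory.GaloisRepresentations.FramedGaloisRep.IsResiduallyAbsIrreducible (ρ.restrictField (CyclotomicField p F)) → Literature.NumberTheory.GaloisRepresentations.FramedGaloisRep.IsResiduallyAbsIrreducible ρ → (∀ v : IsDedekindDomain.HeightOneSpectrum (NumberField.RingOfIntegers F), ((p : ℕ) : NumberField.RingOfIntegers F) ∉ v.asIdeal → ρ.IsUnramifiedAt v) → ∃ g : ℤ, ∀ (v : IsDedekindDomain.HeightOneSpectrum (NumberField.RingOfIntegers F)) (hv : ((p : ℕ) : NumberField.RingOfIntegers F) ∈ v.asIdeal), letI := (Literature.NumberTheory.PAdicHodge.fontainePstAdicCompletion v p hv).algebra;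 ∀ τ : v.adicCompletion F →ₐ[ℚ_[p]] PadicAlgCl p, ∃ a : ℤ, ρ.labelledHodgeTateWeightsAt v (Literature.NumberTheory.PAdicHodge.fontainePstAdicCompletion v p hv).algebra (Literature.NumberTheory.PAdicHodge.fontainePstAdicCompletion v p hv).𝔅 τ.toRingHom = {a, a + g}

/-- **Side lemma (split `p`, the Eisenstein cell is empty).** At split `p ≥ 3`, FL-crystalline and
not nearly ordinary force `ρ̄` absolutely irreducible over `F` (an irreducible Fontaine–Laffaille
crystalline representation of `G_(ℚ_p)` has irreducible reduction `ind ω₂^g`). -/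
def SplitEisensteinCellEmpty : Prop :=
  ∀ (F : Type) [Field F] [NumberField F] [Algebra.IsQuadraticExtension ℚ F], NumberField.IsTotallyComplex F → ∀ (p : ℕ) [Fact p.Prime] (ρ : Literature.NumberTheory.GaloisRepresentations.FramedGaloisRep F (PadicAlgCl p) 2), ρ.toGaloisRep.IsIrreducible → (∀ᶠ v : IsDedekindDomain.HeightOneSpectrum (NumberField.RingOfIntegers F) in Filter.cofinite, ρ.IsUnramifiedAt v) → (∀ (v : IsDedekindDomain.HeightOneSpectrum (NumberField.RingOfIntegers F)) (hv : ((p : ℕ) : NumberField.RingOfIntegers F) ∈ v.asIdeal), (Literature.NumberTheory.PAdicHodge.fontainePstAdicCompletion v p hv).IsDeRhamFramed (ρ.toLocal v) ∧ (letI := (Literature.NumberTheory.PAdicHodge.fontainePstAdicCompletion v p hv).algebra; ∀ τ : v.adicCompletion F →ₐ[ℚ_[p]] PadicAlgCl p, ∃ a b : ℤ, a < b ∧ ρ.labelledHodgeTateWeightsAt v (Literature.NumberTheory.PAdicHodge.fontainePstAdicCompletion v p hv).algebra (Literature.NumberTheory.PAdicHodge.fontainePstAdicCompletion v p hv).𝔅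 τ.toRingHom = {a, b})) → ¬ (∀ v : IsDedekindDomain.HeightOneSpectrum (NumberField.RingOfIntegers F), ((p : ℕ) : NumberField.RingOfIntegers F) ∈ v.asIdeal → Literature.NumberTheory.GaloisRepresentations.FramedRep.HasInvariantCompleteFlag (ρ.toLocal v)) → 3 ≤ p → (∃ v w : IsDedekindDomain.HeightOneSpectrum (NumberField.RingOfIntegers F), v ≠ w ∧ ((p : ℕ) : NumberField.RingOfIntegers F) ∈ v.asIdeal ∧ ((p : ℕ) : NumberField.RingOfIntegers F) ∈ w.asIdeal) → (∀ (v : IsDedekindDomain.HeightOneSpectrum (NumberField.RingOfIntegers F)) (hv : ((p : ℕ) : NumberField.RingOfIntegers F) ∈ v.asIdeal), (Literature.NumberTheory.PAdicHodge.fontainePstAdicCompletion v p hv).IsCrystallineFramed (ρ.toLocal v)) → (∀ (v : IsDedekindDomain.HeightOneSpectrum (NumberField.RingOfIntegers F)) (hv : ((p : ℕ) : NumberField.RingOfIntegers F) ∈ v.asIdeal), letI := (Literature.NumberTheory.PAdicHodge.fontainePstAdicCompletion v p hv).algebra; ∀ (τ : v.adicCompletion F →ₐ[ℚ_[p]] PadicAlgCl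 p) (a b : ℤ), ρ.labelledHodgeTateWeightsAt v (Literature.NumberTheory.PAdicHodge.fontainePstAdicCompletion v p hv).algebra (Literature.NumberTheory.PAdicHodge.fontainePstAdicCompletion v p hv).𝔅 τ.toRingHom = {a, b} → a < b → b - a + 2 ≤ (p : ℤ)) → Literature.NumberTheory.GaloisRepresentations.FramedGaloisRep.IsResiduallyAbsIrreducible ρ

end CyclotomicDihedralPinch

/-! ## Idea `eisenstein-empty-weight-sandwich` -/
namespace EisensteinSandwich

/-- **Target of the sandwich (the cell statement the line proves).** `F` imaginary quadratic,
`p ≥ 5` INERT (unramified, no two distinct primes above `p`), `ρ` as in the crux, not nearly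
ordinary, FL-crystalline at the place above `p`, and `ρ̄` absolutely REDUCIBLE over `F`
(`ρ̄^ss = χ̄₁ ⊕ χ̄₂`).  Then the two labelled gaps are equal.  Proof plan: (A1) the reduction is of
MIXED type, so the Ribet class lies in a balanced (rank-0) Selmer group of the critical Hecke
character `ψ` of `∞`-type `(g₀, -g₁)`; (A2) Rubin's elliptic-unit main conjecture bounds
`#R^λ/I_re ≤ #𝒪/L^alg(0,ψ)`; (A3) Harder–Berger Eisenstein denominators in the non-parallel weight
`λ` bound the Eisenstein congruence module of TORSION Bianchi cohomology from below by the same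
value; (A4) torsion Eisenstein Galois determinants with FL local–global compatibility give
`R^(ps,λ) ↠ 𝕋^λ_𝔪`; (A5) a Berger–Klosin / Wake–Wang-Erickson numerical criterion gives
`R^(ps,λ) = 𝕋^λ_𝔪`, whose characteristic-zero points are Eisenstein (Harder: no cusp forms in
non-parallel weight), so `ρ` would be reducible. -/
def EmptyEisensteinWeight : Prop :=
  ∀ (F : Type) [Field F] [NumberField F] [Algebra.IsQuadraticExtension ℚ F], NumberField.IsTotallyComplex F → ∀ (p : ℕ) [Fact p.Prime] (ρ : Literature.NumberTheory.GaloisRepresentations.FramedGaloisRep F (PadicAlgCl p) 2), ρ.toGaloisRep.IsIrreducible → (∀ᶠ v : IsDedekindDomain.HeightOneSpectrum (NumberField.RingOfIntegers F) in Filter.cofinite, ρ.IsUnramifiedAt v) → (∀ (v : IsDedekindDomain.HeightOneSpectrum (NumberField.RingOfIntegers F)) (hv : ((p : ℕ) : NumberField.RingOfIntegers F) ∈ v.asIdeal), (Literature.NumberTheory.PAdicHodge.fontainePstAdicCompletion v p hv).IsDeRhamFramed (ρ.toLocal v) ∧ (letI := (Literature.NumberTheory.PAdicHodge.fontainePstAdicCompletion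 v p hv).algebra; ∀ τ : v.adicCompletion F →ₐ[ℚ_[p]] PadicAlgCl p, ∃ a b : ℤ, a < b ∧ ρ.labelledHodgeTateWeightsAt v (Literature.NumberTheory.PAdicHodge.fontainePstAdicCompletion v p hv).algebra (Literature.NumberTheory.PAdicHodge.fontainePstAdicCompletion v p hv).𝔅 τ.toRingHom = {a, b})) → ¬ (∀ v : IsDedekindDomain.HeightOneSpectrum (NumberField.RingOfIntegers F), ((p : ℕ) : NumberField.RingOfIntegers F) ∈ v.asIdeal → Literature.NumberTheory.GaloisRepresentations.FramedRep.HasInvariantCompleteFlag (ρ.toLocal v)) → 5 ≤ p → Algebra.IsUnramifiedIn (NumberField.RingOfIntegers F) (Ideal.span {(p : ℤ)}) → ¬ (∃ v w : IsDedekindDomain.HeightOneSpectrum (NumberField.RingOfIntegers F), v ≠ w ∧ ((p : ℕ) : NumberField.RingOfIntegers F) ∈ v.asIdeal ∧ ((p : ℕ) : NumberField.RingOfIntegers F) ∈ w.asIdeal) → (∀ (v : IsDedekindDomain.HeightOneSpectrum (NumberField.RingOfIntegers F)) (hv : ((p : ℕ) : NumberField.RingOfIntegers F) ∈ v.asIdeal),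 (Literature.NumberTheory.PAdicHodge.fontainePstAdicCompletion v p hv).IsCrystallineFramed (ρ.toLocal v)) → (∀ (v : IsDedekindDomain.HeightOneSpectrum (NumberField.RingOfIntegers F)) (hv : ((p : ℕ) : NumberField.RingOfIntegers F) ∈ v.asIdeal), letI := (Literature.NumberTheory.PAdicHodge.fontainePstAdicCompletion v p hv).algebra; ∀ (τ : v.adicCompletion F →ₐ[ℚ_[p]] PadicAlgCl p) (a b : ℤ), ρ.labelledHodgeTateWeightsAt v (Literature.NumberTheory.PAdicHodge.fontainePstAdicCompletion v p hv).algebra (Literature.NumberTheory.PAdicHodge.fontainePstAdicCompletion v p hv).𝔅 τ.toRingHom = {a, b} → a < b → b - a + 2 ≤ (p : ℤ)) → ¬ Literature.NumberTheory.GaloisRepresentations.FramedGaloisRep.IsResiduallyAbsIrreducible ρ → ∃ g : ℤ, ∀ (v : IsDedekindDomain.HeightOneSpectrum (NumberField.RingOfIntegers F)) (hv : ((p : ℕ) : NumberField.RingOfIntegers F) ∈ v.asIdeal), letI := (Literature.NumberTheory.PAdicHodge.fontainePstAdicCompletion v p hv).algebra; ∀ τ : v.adicCompletion F →ₐ[ℚ_[p]]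 PadicAlgCl p, ∃ a : ℤ, ρ.labelledHodgeTateWeightsAt v (Literature.NumberTheory.PAdicHodge.fontainePstAdicCompletion v p hv).algebra (Literature.NumberTheory.PAdicHodge.fontainePstAdicCompletion v p hv).𝔅 τ.toRingHom = {a, a + g}

end EisensteinSandwich

end Summit.Langlands.Langlands.Cruxes.ResidueParallel
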